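import Summits.ValiantsHypothesis.ValiantsHypothesis.Theses.KPlusLogSqLaw
import Summits.ValiantsHypothesis.ValiantsHypothesis.Theorems.LacunarySymmetroidMatrixDescartesCensusTropicalKLaw
import Summits.ValiantsHypothesis.ValiantsHypothesis.Theorems.LacunarySymmetroidMatrixDescartesStubNegRoots
import Summits.ValiantsHypothesis.ValiantsHypothesis.Theorems.LacunarySymmetroidMatrixDescartesCensusFrame
import Summits.ValiantsHypothesis.ValiantsHypothesis.Theorems.KPlusLogSqLawWeakLiftingBridge
import Summits.ValiantsHypothesis.ValiantsHypothesis.Theorems.KPlusLogSqLawWeakLiftingTowerGraftDissociated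
import Summits.ValiantsHypothesis.ValiantsHypothesis.Theorems.KPlusLogSqLawWeakLiftingTowerGraftDigitExpansion
import Summits.ValiantsHypothesis.ValiantsHypothesis.Theorems.KPlusLogSqLawWeakLiftingTowerGraftReduction
import Summits.ValiantsHypothesis.ValiantsHypothesis.Theorems.KPlusLogSqLawWeakLiftingTowerGraftDissociatedB
import Summits.ValiantsHypothesis.ValiantsHypothesis.Theorems.KPlusLogSqLawWeakLiftingTowerGraftCongruencePD
import Summits.ValiantsHypothesis.ValiantsHypothesis.Theorems.KPlusLogSqLawWeakLiftingTowerGraftCornerReduction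
import Summits.ValiantsHypothesis.ValiantsHypothesis.Theorems.KPlusLogSqLawWeakLiftingTowerGraftCornerOfSizeDoubling
import Summits.ValiantsHypothesis.ValiantsHypothesis.Theorems.KPlusLogSqLawWeakLiftingTowerGraftDoublingChain
import Summits.ValiantsHypothesis.ValiantsHypothesis.Theorems.KPlusLogSqLawWeakLiftingTowerGraftSizeMono
import Summits.ValiantsHypothesis.ValiantsHypothesis.Theorems.LacunarySymmetroidTowerDoor
import Summits.ValiantsHypothesis.ValiantsHypothesis.Theorems.TowerDoorS5Conjecture

/-!
# LINE `tower_graft` — crux `WeakLifting` (stmt-ValiantsHypothesis-19561), declared R266 (B) 2026-08-28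

Card: `Cruxes/WeakLifting/Lines/tower_graft.md` (idea `Cruxes/WeakLifting/Ideas/tower-graft.md`, verdict crit-6 #4
PASS-WITH-PRICE).  RESTRICTED TARGET (D-0145 ideation wave): `TowerWeakLifting` = the crux restricted to TOWER supports
(`m·d l < d l'` for `l < l'`: the lex chambers; the record staircase `DPR.expo` is a tower for all parameters), reached from
the ONE-LETTER GRAFT LAW (GL) `stub_oneLetterGraftLaw` by PROVED joints; plus the framing lemma (L1) B ⟺ DissociatedB.
VP ≠ VNP is NOT proved by any of this; `WeakLifting` itself is concluded below only from the B-equivalent HYPOTHESIS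
`DissociatedB` (not a stub) — the honest distance from the line's target to the crux.

Stubs (sorry ONLY here): S1 `stub_digitExpansion` (L2) [CLOSED BY NAME rev 4: `Theorems/KPlusLogSqLawWeakLiftingTowerGraftDigitExpansion.lean`,
lift-p3 g16 p647968] · S2 `stub_blowupDissociated`, `stub_towerTieBreaker` [CLOSED BY NAME rev 3:
`Theorems/KPlusLogSqLawWeakLiftingTowerGraftDissociated.lean`, lift-p2 g17 p646383] ·
S3 `stub_dissociationReduction` (L1) [CLOSED BY NAME rev 5:
`Theorems/KPlusLogSqLawWeakLiftingTowerGraftReduction.lean`, lift-p2 g17 p648275] · S4 `stub_graftLawId` (GL-Id, rung below S5; rev 4 re-cut of `stub_graftLawPSD`) [research-M] +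
S4a `stub_congruencePD` [CLOSED BY NAME rev 5: `…TowerGraftCongruencePD.lean`, lift-p3 g16 p650393] + S4b `stub_graftLawCorner` (GL-corner = rank-one graft in normal form, first honest piece; rev 5)
[research-M] + S4c `stub_cornerReduction` [CLOSED BY NAME rev 6: `…TowerGraftCornerReduction.lean`, lift-p2 g17 p653433] + S4d `stub_sizeDoubling` (SD, fixed-support class law; rev 6) [research-M] +
S4e `stub_cornerOfSizeDoubling` [CLOSED BY NAME rev 7: `…TowerGraftCornerOfSizeDoubling.lean`, lift-p3 g16 p654716] +
S4f `stub_sizeDoublingPoly` (SD-poly, rev 8) [research-M] + S4g `stub_sizeMono` [CLOSED BY NAME rev 9: `…TowerGraftSizeMono.lean`, lift-p3 g17 p658112] + S4h `stub_doublingChain` [CLOSED BY NAME rev 9: `…TowerGraftDoublingChain.lean`, lift-p2 g18 p657997] ·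
S5 `stub_oneLetterGraftLaw` (GL)
[research — the line's crux].  Heads (no sorry): `towerWeakLifting_of : TowerGraftLaw → TowerWeakLifting` (letter induction),
`towerWeakLifting_of_sizeDoubling` (size induction, rev 8: through S4f + S4g + S4h), `kPlusLogSqLaw_iff_dissociatedB_of`, `WeakLifting_of_dissociatedB`;
rev 10 (δ-only, the TOWER DOOR landed in `Theorems/LacunarySymmetroidTowerDoor.lean`, val-sym-eng-2 g7, director R300/R301): `valiant_of_graftLaw :
TowerGraftLaw → ValiantsHypothesis` and `valiant_of_sizeDoublingPoly : TowerSizeDoublingPoly → ValiantsHypothesis` through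
`…Theorems.LacunarySymmetroid.TowerDoor.valiant_of_towerB_alone` (whose hypothesis text IS `TowerB`, `towerB_door_iff := Iff.rfl`) — S5 ALONE and
S4f ALONE are summit-deciding BY NAME; both remain OPEN research stubs, so VP ≠ VNP is NOT proved;
rev 11 (the POLYLOG spine, door currency): `TowerGraftLawPolylog` (GLᴸ, stub S5ᴸ `stub_graftLawPolylog`, WEAKER than S5 by
`graftLawPolylog_of_graftLaw`) ⇒ `TowerPolylogLaw` ⇒ `TowerMDR` (the door's first binder; joint `towerMDR_of_towerPolylogLaw` PROVED) ⇒
`ValiantsHypothesis` (`valiant_of_towerPolylogLaw`, `valiant_of_graftLawPolylog`, axioms standard) — conditional heads, nothing unconditional;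
rev 12 (δ-only): S5 NAMED in Theorems as `…Theorems.TowerDoorS5.TowerGraftLaw` (p677624, the `TowerDoorS5` bridge's conjecture) —
pins `towerGraftLaw_doorS5_iff := Iff.rfl` and `valiant_of_graftLaw_byDoorS5`; no new claim.
-/

set_option linter.dupNamespace false
set_option autoImplicit false

namespace Summit.ValiantsHypothesis.ValiantsHypothesis.Cruxes.WeakLifting.TowerGraftLine

open scoped BigOperators
open Polynomial
open Summit.ValiantsHypothesis.ValiantsHypothesis.Theorems.LacunarySymmetroidMatrixDescartes
  (RealRootLawAt KPlusLogSqLaw PosRootLawOn)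
open Summit.ValiantsHypothesis.ValiantsHypothesis.Theorems.LacunarySymmetroidMatrixDescartes.TropicalCensus
  (TropRootLawAt)
open Summit.ValiantsHypothesis.ValiantsHypothesis.Theses.KPlusLogSqLaw (WeakLifting)

/-- `d` is an `m`-TOWER: every exponent exceeds `m` times every earlier one (lex chamber; forces `StrictMono d`
when `m ≥ 1`). -/
def IsTower (m : ℕ) {K : ℕ} (d : Fin K → ℕ) : Prop :=
  ∀ l l' : Fin K, l < l' → m * d l < d l'

/-- `d` is `m`-DISSOCIATED (a `B_m`-set for compositions): distinct class-count vectors `n` of total `m` give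
distinct exponents `∑ n l · d l`.  Towers are dissociated; so is every generic real support. -/
def IsDissociated (m : ℕ) {K : ℕ} (d : Fin K → ℕ) : Prop :=
  ∀ n n' : Fin K → ℕ, ∑ l, n l = m → ∑ l, n' l = m → ∑ l, n l * d l = ∑ l, n' l * d l → n = n'

/-- **TOWER-B** — the restricted V2 sub-case this idea would PROVE: Conjecture B (`KPlusLogSqLaw`, positive-root
currency `PosRootLawOn`) on tower supports, uniformly in `m` and `K`. -/
def TowerB : Prop :=
  ∃ C : ℕ, ∀ (m K : ℕ) (d : Fin K → ℕ), IsTower m d → PosRootLawOn m K (2 ^ (C * (K + Nat.log 2 m ^ 2))) d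

/-- **DISSOCIATED-B** — B on all `m`-dissociated supports (by `DissociationReduction` this is ALL of B). -/
def DissociatedB : Prop :=
  ∃ C : ℕ, ∀ (m K : ℕ) (d : Fin K → ℕ), IsDissociated m d →
    PosRootLawOn m K (2 ^ (C * (K + Nat.log 2 m ^ 2))) d

/-- **FIRST LEMMA (L1) — DISSOCIATION REDUCTION / blow-up monotonicity.**  A support-level row bound on the BLOWN-UP
support `N·d + e` (`e` dissociated, `N > m·max e`) gives the same bound on `d`: lower bounds transfer from every chamber
to its `e`-refinement (proof: `u ↦ det ∑ u^{d l + e l / N} S l → det ∑ u^{d l} S l` locally uniformly on `u > 0` as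
`N → ∞`, so an alternation certificate of `d` survives at `t = u^{1/N}`; census currency via the tree's
alternation ↔ distinct-root bridges). -/
def DissociationReduction : Prop :=
  ∀ (m K B : ℕ) (d e : Fin K → ℕ), IsDissociated m e →
    (∀ N : ℕ, (∀ l, m * e l < N) → PosRootLawOn m K B (fun l => N * d l + e l)) → PosRootLawOn m K (2 * B + 1) d

/-- corollary of (L1) with the tower tie-breaker `e l = (m+1)^l`: B is a statement about dissociated chambers only. -/
def KPlusLogSqLaw_of_dissociatedB : Prop := DissociatedB → KPlusLogSqLaw

/-- **LEMMA (L2) — TOWER DIGIT EXPANSION.**  Grafting a far letter `X^D • S` (`D > m · max d`) on a pencil `G` of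
support `d`: `det (G + X^D S) = ∑_{j ≤ m} X^{j D} · E j` where `E j` is the `T^j`-coefficient of the bivariate pencil
determinant `det (G + T·S)` and `natDegree (E j) < D` — the determinant is the base-`X^D` digit string of
`Q(X,T) = det(G + T S)`, i.e. `det F = Q(X, X^D)` with non-overlapping digits. -/
def TowerDigitExpansion : Prop :=
  ∀ (m K D : ℕ) (d : Fin K → ℕ) (S : Fin K → Matrix (Fin m) (Fin m) ℝ) (Stop : Matrix (Fin m) (Fin m) ℝ),
    (∀ l, m * d l < D) → 0 < D →
    let G : Matrix (Fin m) (Fin m) ℝ[X] := ∑ l, (X : ℝ[X]) ^ d l • (S l).map Polynomial.C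
    let Q : Polynomial ℝ[X] := (G.map (C : ℝ[X] →+* Polynomial ℝ[X]) +
      (X : Polynomial ℝ[X]) • Stop.map ((C : ℝ[X] →+* Polynomial ℝ[X]).comp (C : ℝ →+* ℝ[X]))).det
    (G + (X : ℝ[X]) ^ D • Stop.map Polynomial.C).det = ∑ j ∈ Finset.range (m + 1), (X : ℝ[X]) ^ (D * j) * Q.coeff j ∧
      ∀ j, (Q.coeff j).natDegree < D ∨ Q.coeff j = 0

/-- **THE GRAFT LAW (GL) — the crux-level target of the line.**  On a tower, grafting ONE far letter costs at most a
constant FACTOR plus a QUASI-POLYNOMIAL additive term: `ζ₊(m; d ⊔ D) ≤ 2^C · ζ₊(m; d) + 2^{C log₂² m}`.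
(The additive term is forced: `K = 3` towers are Descartes-sharp `C(m+2,2) − 1` (Disproof §D items 2/7, Vinnikov) while
`ζ₊(m;2 letters) = m`; the staircase family (L ≥ 6) lives on towers with `log ζ ≈ (K/6)·log m` at `K ≲ log m`.) -/
def TowerGraftLaw : Prop :=
  ∃ C : ℕ, ∀ (m K B D : ℕ) (d : Fin K → ℕ), IsTower m d → (∀ l, m * d l < D) →
    PosRootLawOn m K B d →
    PosRootLawOn m (K + 1) (2 ^ C * B + 2 ^ (C * Nat.log 2 m ^ 2)) (Fin.snoc d D)

/-- (GL) iterated along the tower gives TOWER-B (induction on `K`; `B_{K+1} = 2^C B_K + 2^{C L²}`, `B_1 = 0`). -/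
def TowerB_of_graftLaw : Prop := TowerGraftLaw → TowerB

/-- **Bearing on the crux.**  `WeakLifting` RESTRICTED TO TOWER SUPPORTS (a literal sub-case of stmt-19561: the
format-level tropical hypothesis, the conclusion only for tower `d`). -/
def TowerWeakLifting : Prop :=
  ∃ C : ℕ, ∀ (m K n : ℕ), TropRootLawAt m K n → ∀ (d : Fin K → ℕ), IsTower m d →
    ∀ (S : Fin K → Matrix (Fin m) (Fin m) ℝ), (∀ l, (S l).IsSymm) →
      (Matrix.det (∑ l, ((X : ℝ[X]) ^ d l) • (S l).map Polynomial.C)).roots.toFinset.card ≤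
        2 ^ (C * (K + Nat.log 2 m ^ 2)) * (n + 1)

/-- the crux gives the tower sub-case (restriction), and TOWER-B gives it with NO tropical input
(`card ≤ 2·ζ₊ + 1 ≤ 2^{(C+1)(K+L²)}·(n+1)`). -/
def TowerWeakLifting_of_weakLifting : Prop := WeakLifting → TowerWeakLifting
def TowerWeakLifting_of_towerB : Prop := TowerB → TowerWeakLifting

/-- **RUNG (M1) — the graft law for a SEMIDEFINITE far letter** (`TowerGraftLawPSD`, (GL)-shape: a literal special case of
`TowerGraftLaw`, see `towerGraftLawPSD_of_graftLaw`).  Mechanism: for `P ⪰ 0` the fibres `T ↦ det(G(t) + T·P) = det G·det(I + T·WᵀG⁻¹W)`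
are real-rooted, the positive zero set of `Q(t,T) = det(G(t)+T·P)` is a union of real-analytic branch arcs `T = −1/μ_i(t)` delimited by the
zeros of `E 0 = det G` and of the top digit `E r` (a compression determinant of `G`: same tower, one letter fewer — paid by the budget `B`),
and each arc meets `T = t^D` at most `1 + #{points of log-slope D}` times (digit expansion `TowerDigitExpansion` = S1 is the algebra
underneath).  Does NOT cover the record family: the staircase's far letter is indefinite (price P3). -/
def TowerGraftLawPSD : Prop :=
  ∃ C : ℕ, ∀ (m K B D : ℕ) (d : Fin K → ℕ), IsTower m d → (∀ l, m * d l < D) → PosRootLawOn m K B d →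
    ∀ (S : Fin K → Matrix (Fin m) (Fin m) ℝ) (P : Matrix (Fin m) (Fin m) ℝ), (∀ l, (S l).IsSymm) → P.PosSemidef →
      ((Matrix.det ((∑ l, ((X : ℝ[X]) ^ d l) • (S l).map Polynomial.C) + (X : ℝ[X]) ^ D • P.map Polynomial.C)).roots.toFinset.filter
        (fun t => 0 < t)).card ≤ 2 ^ C * B + 2 ^ (C * Nat.log 2 m ^ 2)

/-- **(GL-Id) THE IDENTITY GRAFT LAW** — rev 4 re-cut of the semidefinite rung: graft the IDENTITY matrix at a tower-top
exponent.  Equivalently (eigencurve form): for a symmetric tower pencil `G(t)` on `d`, the eigenvalue curves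
`{(t,λ) : det(G(t) − λ·1) = 0}` meet the steep arc `λ = −t^D` (`D > m·max d`) in at most `2^C·ζ₊(m;d) + 2^{C·log₂²m}` points,
although each HORIZONTAL line meets them in at most `ζ₊(m;d)` points.  By congruence (`stub_congruencePD`) this is the whole
positive-definite far-letter case; the record staircase (indefinite far letter) is NOT covered — price (P3). -/
def TowerGraftLawId : Prop :=
  ∃ C : ℕ, ∀ (m K B D : ℕ) (d : Fin K → ℕ), IsTower m d → (∀ l, m * d l < D) → PosRootLawOn m K B d →
    ∀ (S : Fin K → Matrix (Fin m) (Fin m) ℝ), (∀ l, (S l).IsSymm) →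
      ((Matrix.det ((∑ l, ((X : ℝ[X]) ^ d l) • (S l).map Polynomial.C) +
          (X : ℝ[X]) ^ D • (1 : Matrix (Fin m) (Fin m) ℝ[X]))).roots.toFinset.filter
        (fun t => 0 < t)).card ≤ 2 ^ C * B + 2 ^ (C * Nat.log 2 m ^ 2)

/-- **(GL-PD)** the graft law for a positive DEFINITE far letter (same constant as (GL-Id) by congruence). -/
def TowerGraftLawPD : Prop :=
  ∃ C : ℕ, ∀ (m K B D : ℕ) (d : Fin K → ℕ), IsTower m d → (∀ l, m * d l < D) → PosRootLawOn m K B d →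
    ∀ (S : Fin K → Matrix (Fin m) (Fin m) ℝ) (P : Matrix (Fin m) (Fin m) ℝ), (∀ l, (S l).IsSymm) → P.PosDef →
      ((Matrix.det ((∑ l, ((X : ℝ[X]) ^ d l) • (S l).map Polynomial.C) + (X : ℝ[X]) ^ D • P.map Polynomial.C)).roots.toFinset.filter
        (fun t => 0 < t)).card ≤ 2 ^ C * B + 2 ^ (C * Nat.log 2 m ^ 2)

/-- **(GL-rk1) THE RANK-ONE GRAFT LAW** — the FIRST HONEST PIECE of the graft calculus (rev 5): graft `t^D·v vᵀ` (one PSD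
rank-one far letter; after congruence: add `t^D` to ONE diagonal entry).  Fibre structure is a SINGLE arc: `det(G + T·v vᵀ) =
det G + T·(vᵀ adj G v)` is linear in `T`, and for `v = e₁` the slope `det G₁₁` is again a determinant of a symmetric pencil on `d`
(size `m−1`, so inside the class budget); Schur form `g₁₁(t) + t^D = b(t)ᵀ G₁₁(t)⁻¹ b(t)`.  Not implied by (GL-Id)/(GL-PD) (singular
far letter) but implied by the semidefinite rung and by (GL) (`towerGraftLawRankOne_of_PSD`). -/
def TowerGraftLawRankOne : Prop :=
  ∃ C : ℕ, ∀ (m K B D : ℕ) (d : Fin K → ℕ), IsTower m d → (∀ l, m * d l < D) → PosRootLawOn m K B d →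
    ∀ (S : Fin K → Matrix (Fin m) (Fin m) ℝ) (v : Fin m → ℝ), (∀ l, (S l).IsSymm) →
      ((Matrix.det ((∑ l, ((X : ℝ[X]) ^ d l) • (S l).map Polynomial.C) +
          (X : ℝ[X]) ^ D • (Matrix.vecMulVec v v).map Polynomial.C)).roots.toFinset.filter
        (fun t => 0 < t)).card ≤ 2 ^ C * B + 2 ^ (C * Nat.log 2 m ^ 2)

/-- **(GL-corner) THE CORNER GRAFT LAW** — (GL-rk1) in normal form: add `t^D` to ONE diagonal entry `(i,i)`.  Then
`det(G + t^D·eᵢeᵢᵀ) = det G + t^D·det G_{ii}` (cofactor expansion): the root problem of `A(t) + t^D·E(t)` where `A = det G`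
and `E = det G_{ii}` are BOTH determinants of symmetric pencils on `d` (sizes `m`, `m−1`; Cauchy-interlacing eigenvalues), so
both carry the class budget.  The research kernel of S4b. -/
def TowerGraftLawCorner : Prop :=
  ∃ C : ℕ, ∀ (m K B D : ℕ) (d : Fin K → ℕ), IsTower m d → (∀ l, m * d l < D) → PosRootLawOn m K B d →
    ∀ (S : Fin K → Matrix (Fin m) (Fin m) ℝ) (i : Fin m), (∀ l, (S l).IsSymm) →
      ((Matrix.det ((∑ l, ((X : ℝ[X]) ^ d l) • (S l).map Polynomial.C) +
          (X : ℝ[X]) ^ D • (Matrix.vecMulVec (Pi.single i (1 : ℝ)) (Pi.single i (1 : ℝ))).map Polynomial.C)).roots.toFinset.filter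
        (fun t => 0 < t)).card ≤ 2 ^ C * B + 2 ^ (C * Nat.log 2 m ^ 2)

/-- **(SD) TOWER SIZE-DOUBLING** — rev 6 research rung suggested by lift-p3 g16's residual-determinant theorem
(`card_posRoots_rankOneGraft_le`: corner graft ≤ 2B + B′ + 1 with B′ the class budget at size 2m+1, for EVERY far exponent):
a pure CLASS law at FIXED support INSIDE THE WINDOW `K ≤ m+1` (crit-6 price 17:23Z: unguarded it would also assert, at `m+1 = 2`,
«3×3 towers are at most a constant factor richer than 2×2 ones uniformly in K», which the Descartes-sharp census trend
`ζ(2,K) = C(K+1,2) − 1 (K ≤ 5)`, `ζ(3,4) ∈ {18,19}` contradicts for the wrong reason) — how `ζ₊` grows with the SIZE at fixed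
`(d, K)` (the `log² m` half of Conjecture B).  With
the residual-determinant theorem it implies (GL-corner) (`towerGraftLawCorner_of_sizeDoubling`).  HONEST RISK: iterated from size 2
it gives `ζ₊(m;d) ≲ m^C·ζ₊(2;d) + q(m)·log m` (polynomial in K at fixed m), so it bets on non-sharpness of Descartes from
`K ≈ C·log m` on, where B itself only needs it from `K ≈ m/4^C`; consistent with the census maxima at `C = 1`. -/
def TowerSizeDoubling : Prop :=
  ∃ C : ℕ, ∀ (m K B : ℕ) (d : Fin K → ℕ), K ≤ m + 1 → IsTower (m + 1) d → PosRootLawOn (m + 1) K B d →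
    PosRootLawOn (m + 1 + m) K (2 ^ C * B + 2 ^ (C * Nat.log 2 (m + 1) ^ 2)) d

/-- **(GL-corner, WINDOW form)** — the corner graft law inside the content window `K ≤ m` (fewer letters than the size);
outside it Conjecture B is Descartes' count.  Target of the size-doubling attack (S4d + S4e); implied by (GL-corner). -/
def TowerGraftLawCornerW : Prop :=
  ∃ C : ℕ, ∀ (m K B D : ℕ) (d : Fin K → ℕ), K ≤ m → IsTower m d → (∀ l, m * d l < D) → PosRootLawOn m K B d →
    ∀ (S : Fin K → Matrix (Fin m) (Fin m) ℝ) (i : Fin m), (∀ l, (S l).IsSymm) →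
      ((Matrix.det ((∑ l, ((X : ℝ[X]) ^ d l) • (S l).map Polynomial.C) +
          (X : ℝ[X]) ^ D • (Matrix.vecMulVec (Pi.single i (1 : ℝ)) (Pi.single i (1 : ℝ))).map Polynomial.C)).roots.toFinset.filter
        (fun t => 0 < t)).card ≤ 2 ^ C * B + 2 ^ (C * Nat.log 2 m ^ 2)

/-- **(SD-poly, FAT form) size-doubling with a POLYNOMIAL factor on FAT formats** (rev 8; crit-6 addendum #7g R-a + R-b — the
B-consistent form): on formats `2^C·K ≤ m+1`, `ζ₊(2m+1; d) ≤ (m+2)^C·ζ₊(m+1; d) + 2^{C·log₂²(m+1)}` (ONE `C` couples guard and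
factor, so the claim is monotone in `C`).  `log₂ m` doublings × factor `m^C` = `2^{C·log₂² m}` — this IS where the `log² m` of
Conjecture B comes from on the size-induction side; implied by (SD) (`towerSizeDoublingPoly_of_sizeDoubling`), and sufficient for
TowerB (`TowerB_of_sizeDoubling`, S4h: thinner formats `2^C·K > m` are Descartes outright, `ζ₊ < 2^{(2^C+1)K}`).  The fat guard keeps
the spine's first doubling OFF the near-square edge `K → 2K−1`, where (SD) is strictly riskier than B (#7g); what remains is the bet B
itself makes: tower supports are not Descartes-sharp on fat formats. -/
def TowerSizeDoublingPoly : Prop :=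
  ∃ C : ℕ, ∀ (m K B : ℕ) (d : Fin K → ℕ), 2 ^ C * K ≤ m + 1 → IsTower (m + 1) d → PosRootLawOn (m + 1) K B d →
    PosRootLawOn (m + 1 + m) K ((m + 2) ^ C * B + 2 ^ (C * Nat.log 2 (m + 1) ^ 2)) d

/-- **size monotonicity of the class budget**: a positive-root bound for all size-`m'` pencils on the support `d` bounds the
size-`m ≤ m'` ones (block-diagonal embedding `G ⊕ X^{d 0}·1`, which only adds roots at `0`). -/
def PosRootLawSizeMono : Prop :=
  ∀ (m m' K B : ℕ) (d : Fin K → ℕ), m ≤ m' → PosRootLawOn m' K B d → PosRootLawOn m K B d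

/-- **THE SIZE-INDUCTION SPINE** (rev 8): (SD-poly) + size monotonicity ⇒ TowerB — start from Descartes' count at size
`s₀ = max (2^C·K) 2` (`…StubDescartesCeiling`: `ζ₊ + 1 ≤ C(s₀+K−1, s₀) ≤ 2^{s₀+K−1} ≤ 2^{(2^C+1)K+1}`), double `J ≤ log₂ m + 1`
times (`s ↦ 2s−1`; sizes increase, so the fat guard persists, and every size at which (SD-poly) is invoked is `≤ m`, so `IsTower`
holds), then come down from `s_J ≥ m` by monotonicity: exponent `≤ (2^C+1)K + 1 + C(L+1)² + CL² + L + 3 ≤ (2^C+5C+8)(K + L²)`;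
formats `2^C·K > m` are Descartes outright (`ζ₊ < 2^{m+K} ≤ 2^{(2^C+1)K}`).  So Conjecture B on
towers has TWO independent inductions: on LETTERS (GL, cost `2^{C·K}`) and on SIZE (SD, cost `2^{C·log² m}`) — B's two terms. -/
def TowerB_of_sizeDoubling : Prop := TowerSizeDoublingPoly → PosRootLawSizeMono → TowerB

/-! ## Kernel-checked compositions (no `sorry`): the line's joints are real

`towerB_of_graftLaw : TowerB_of_graftLaw` — (GL) iterated along the tower IS TowerB (induction on `K`, constant `C+1`);
`towerWeakLifting_of_weakLifting` — TowerWeakLifting is a literal sub-case of the crux;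
`towerWeakLifting_of_towerB` — TowerB gives it with no tropical input (reflection `stub_negRoots`, constant `C+2`). -/

theorem posRootLawOn_mono {m K B B' : ℕ} {d : Fin K → ℕ} (hBB' : B ≤ B') (h : PosRootLawOn m K B d) :
    PosRootLawOn m K B' d :=
  fun S hS => (h S hS).trans hBB'

/-- the empty format: with no letters the pencil is `0` (or the empty matrix), no positive zeros. -/
theorem posRootLawOn_zero (m B : ℕ) (d : Fin 0 → ℕ) : PosRootLawOn m 0 B d := by
  intro S hS
  have h0 : (∑ l : Fin 0, (Polynomial.X : Polynomial ℝ) ^ d l • (S l).map Polynomial.C) = 0 := by simp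
  rw [h0]
  rcases Nat.eq_zero_or_pos m with hm | hm
  · subst hm
    simp [Matrix.det_isEmpty]
  · haveI : Nonempty (Fin m) := ⟨⟨0, hm⟩⟩
    simp [Matrix.det_zero]

theorem isTower_init {m K : ℕ} {d : Fin (K + 1) → ℕ} (h : IsTower m d) : IsTower m (Fin.init d) :=
  fun l l' hll' => h l.castSucc l'.castSucc (Fin.castSucc_lt_castSucc_iff.mpr hll')

theorem tower_init_lt_last {m K : ℕ} {d : Fin (K + 1) → ℕ} (h : IsTower m d) (l : Fin K) :
    m * Fin.init d l < d (Fin.last K) :=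
  h l.castSucc (Fin.last K) (Fin.castSucc_lt_last l)

/-- the arithmetic of one induction step: `2^C · 2^{(C+1)(K+L²)} + 2^{C L²} ≤ 2^{(C+1)(K+1+L²)}`. -/
theorem graft_step_arith (C K L : ℕ) :
    2 ^ C * 2 ^ ((C + 1) * (K + L ^ 2)) + 2 ^ (C * L ^ 2) ≤ 2 ^ ((C + 1) * (K + 1 + L ^ 2)) := by
  have hA : C * L ^ 2 ≤ (C + 1) * (K + L ^ 2) := by nlinarith [Nat.zero_le (L ^ 2), Nat.zero_le K, Nat.zero_le C]
  have h1 : 2 ^ (C * L ^ 2) ≤ 2 ^ ((C + 1) * (K + L ^ 2)) := Nat.pow_le_pow_right two_pos hA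
  have h2 : 2 ^ ((C + 1) * (K + L ^ 2)) ≤ 2 ^ C * 2 ^ ((C + 1) * (K + L ^ 2)) :=
    Nat.le_mul_of_pos_left _ (Nat.two_pow_pos C)
  have h3 : 2 ^ ((C + 1) * (K + 1 + L ^ 2)) = 2 * (2 ^ C * 2 ^ ((C + 1) * (K + L ^ 2))) := by
    have : (C + 1) * (K + 1 + L ^ 2) = ((C + 1) * (K + L ^ 2) + C) + 1 := by ring
    rw [this, pow_succ, pow_add]; ring
  rw [h3]
  omega

/-- **(GL) iterated = TowerB.** -/
theorem towerB_of_graftLaw : TowerB_of_graftLaw := by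
  rintro ⟨C, hC⟩
  refine ⟨C + 1, ?_⟩
  intro m K
  induction K with
  | zero => intro d _; exact posRootLawOn_zero m _ d
  | succ K ih =>
    intro d hd
    have h₁ : PosRootLawOn m K (2 ^ ((C + 1) * (K + Nat.log 2 m ^ 2))) (Fin.init d) := ih (Fin.init d) (isTower_init hd)
    have h₂ := hC m K _ (d (Fin.last K)) (Fin.init d) (isTower_init hd) (tower_init_lt_last hd) h₁
    rw [Fin.snoc_init_self] at h₂
    exact posRootLawOn_mono (graft_step_arith C K (Nat.log 2 m)) h₂

/-- **TowerWeakLifting is a literal sub-case of the crux `WeakLifting`.** -/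
theorem towerWeakLifting_of_weakLifting : TowerWeakLifting_of_weakLifting := by
  rintro ⟨C, hC⟩
  exact ⟨C, fun m K n hT d _ S hS => hC m K n hT d S hS⟩

/-- **TowerB gives the tower sub-case with no tropical input** (`card ≤ Z₊(S) + Z₊(reflected S) + 1`). -/
theorem towerWeakLifting_of_towerB : TowerWeakLifting_of_towerB := by
  rintro ⟨C, hC⟩
  refine ⟨C + 2, fun m K n _ d hd S hS => ?_⟩
  rcases Nat.eq_zero_or_pos K with hK | hK
  · subst hK
    have h0 : (∑ l : Fin 0, (Polynomial.X : Polynomial ℝ) ^ d l • (S l).map Polynomial.C) = 0 := by simp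
    rw [h0]
    rcases Nat.eq_zero_or_pos m with hm | hm
    · subst hm; simp [Matrix.det_isEmpty]
    · haveI : Nonempty (Fin m) := ⟨⟨0, hm⟩⟩
      simp [Matrix.det_zero]
  · have h1 := hC m K d hd S hS
    have h2 := hC m K d hd (fun l => ((-1 : ℝ) ^ d l) • S l) (fun l => (hS l).smul _)
    have h3 := Summit.ValiantsHypothesis.ValiantsHypothesis.Theorems.LacunarySymmetroidMatrixDescartes.stub_negRoots K m d S
    set A := C * (K + Nat.log 2 m ^ 2) with hAdef
    have h4 : 2 ^ A + 2 ^ A + 1 ≤ 2 ^ ((C + 2) * (K + Nat.log 2 m ^ 2)) * (n + 1) := by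
      have h5 : (C + 2) * (K + Nat.log 2 m ^ 2) = A + 2 * (K + Nat.log 2 m ^ 2) := by rw [hAdef]; ring
      have h6 : 2 ≤ 2 * (K + Nat.log 2 m ^ 2) := by omega
      have h7 : 2 ^ 2 ≤ 2 ^ (2 * (K + Nat.log 2 m ^ 2)) := Nat.pow_le_pow_right two_pos h6
      have h8 : 1 ≤ 2 ^ A := Nat.one_le_two_pow
      calc 2 ^ A + 2 ^ A + 1 ≤ 2 ^ A * 2 ^ 2 := by omega
        _ ≤ 2 ^ A * 2 ^ (2 * (K + Nat.log 2 m ^ 2)) := Nat.mul_le_mul_left _ h7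
        _ = 2 ^ ((C + 2) * (K + Nat.log 2 m ^ 2)) := by rw [h5, pow_add]
        _ ≤ 2 ^ ((C + 2) * (K + Nat.log 2 m ^ 2)) * (n + 1) := Nat.le_mul_of_pos_right _ (Nat.succ_pos n)
    exact h3.trans ((Nat.add_le_add (Nat.add_le_add h1 h2) le_rfl).trans h4)

/-! ## Registered stubs (`sorry` only here) -/

/-- **S1 (L2) digit expansion** [S, prover now; MECHANISM LEMMA for the S4/S5 proofs, not a skeleton joint — verdict #7 (P1)]: `det(G + X^D S) = Σ_j X^{jD}·[T^j]det(G + T·S)`, digits of degree `< D`. -/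
theorem stub_digitExpansion : TowerDigitExpansion := by
  intro m K D d S Stop hD hDpos
  exact Summit.ValiantsHypothesis.ValiantsHypothesis.Theorems.KPlusLogSqLaw.TowerGraft.tower_digitExpansion
    m K D d S Stop hD hDpos

/-- **S2a blow-up stays dissociated** [S, prover now]: `e` `m`-dissociated and `N > m·max e` ⇒ `N·d + e` is `m`-dissociated
(`⟨n, N d + e⟩ = N⟨n,d⟩ + ⟨n,e⟩` with `⟨n,e⟩ < N`: compare quotient and remainder). -/
theorem stub_blowupDissociated : ∀ (m K N : ℕ) (d e : Fin K → ℕ), IsDissociated m e → (∀ l, m * e l < N) →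
    IsDissociated m (fun l => N * d l + e l) := by
  intro m K N d e he hN
  exact Summit.ValiantsHypothesis.ValiantsHypothesis.Theorems.KPlusLogSqLaw.TowerGraft.blowup_dissociated
    m K N d e he hN

/-- **S2b the tower tie-breaker is dissociated** [S, prover now]: `e l = (m+1)^l` (base-`m+1` digits `n l ≤ m`). -/
theorem stub_towerTieBreaker : ∀ (m K : ℕ), IsDissociated m (fun l : Fin K => (m + 1) ^ (l : ℕ)) := by
  intro m K
  exact Summit.ValiantsHypothesis.ValiantsHypothesis.Theorems.KPlusLogSqLaw.TowerGraft.tower_tieBreaker_dissociated m K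

/-- **S3 (L1) dissociation reduction** [M, prover next]: alternation certificates survive the blow-up `u ↦ u^{1/N}`. -/
theorem stub_dissociationReduction : DissociationReduction := by
  intro m K B d e he hlaw
  exact Summit.ValiantsHypothesis.ValiantsHypothesis.Theorems.KPlusLogSqLaw.TowerGraft.dissociation_reduction
    m K B d e he hlaw

/-- **S4 (GL-Id) the identity graft law** [research-M; rev 4 re-cut of the semidefinite rung]: graft `t^D·1` on a tower base — a RUNG
strictly below S5 (`towerGraftLawId_of_graftLaw`) and, with S4a, the whole definite-far-letter case (`towerGraftLawPD_of`).
Real-rooted fibres `T ↦ det(G + T·1)` (eigenvalues of `−G`), branch arcs vs the arc `T = t^D`; S1 is its algebra.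
Does NOT cover the record family (the staircase's far letter is indefinite) — price (P3). -/
theorem stub_graftLawId : TowerGraftLawId := by
  sorry

/-- **S4a congruence reduction** [M, prover]: a positive definite far letter is the identity after the congruence
`G ↦ R⁻¹ G R⁻ᵀ` (`P = R Rᵀ`, `R` invertible — Mathlib `LDL.lower_conj_diag` / `IsHermitian.spectral_theorem`), which keeps
the support `d`, the symmetry of the letters and the root set (`det` scales by `det R² ≠ 0`); same constant `C`. -/
theorem stub_congruencePD : TowerGraftLawId → TowerGraftLawPD := by
  exact Summit.ValiantsHypothesis.ValiantsHypothesis.Theorems.KPlusLogSqLaw.TowerGraft.congruencePD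

/-- **S4b (GL-corner) the corner graft law** [research-M; rev 5 — the first honest piece: ONE arc `T = −det G / det G_{ii}` against
`T = t^D`; events = roots of `det G` and of the principal minor `det G_{ii}` (both inside the class budget) + the dips between]. -/
theorem stub_graftLawCorner : TowerGraftLawCorner := by
  sorry

/-- **S4c corner reduction** [M, prover]: a rank-one far letter `v vᵀ` (`v ≠ 0`) is the corner `e₀e₀ᵀ` after the congruence by
an invertible `R` with `R e₀ = v` (`G ↦ R⁻¹ G R⁻ᵀ` keeps support, symmetry, root set); `v = 0` is the budget `B` itself. -/
theorem stub_cornerReduction : TowerGraftLawCorner → TowerGraftLawRankOne := by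
  exact Summit.ValiantsHypothesis.ValiantsHypothesis.Theorems.KPlusLogSqLaw.TowerGraft.corner_reduction

/-- **S4d (SD) size-doubling at fixed support** [research-M; rev 6 — lift-p3 g16 (R1): with the residual-determinant floor
`corner graft ≤ 2B + B′ + 1` this class law (no graft at all) gives S4b]. -/
theorem stub_sizeDoubling : TowerSizeDoubling := by
  sorry

/-- **S4e joint — CLOSED BY NAME** (rev 7: lift-p3 g16 `cornerOfSizeDoubling`, p654716, constant C+3, via the residual-determinant floor p652288/p652808):
size-doubling ⇒ the corner graft law in the window `K ≤ m` (constant `C+2`). -/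
theorem stub_cornerOfSizeDoubling : TowerSizeDoubling → TowerGraftLawCornerW := by
  exact Summit.ValiantsHypothesis.ValiantsHypothesis.Theorems.KPlusLogSqLaw.TowerGraft.cornerOfSizeDoubling

/-- **S4f (SD-poly, fat form)** [research-M; rev 8]: the B-consistent size-doubling law; implied by S4d. -/
theorem stub_sizeDoublingPoly : TowerSizeDoublingPoly := by
  sorry

/-- **S4g size monotonicity — CLOSED BY NAME** (rev 9: lift-p3 g17 `sizeMono`, p658112; padding `S l ⊕ 1` for every letter via the census kit's
`Census.exists_pad`: `det = det G · (Σ X^{d l})^r`, no new positive root). -/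
theorem stub_sizeMono : PosRootLawSizeMono := by
  exact Summit.ValiantsHypothesis.ValiantsHypothesis.Theorems.KPlusLogSqLaw.TowerGraft.sizeMono

/-- **S4h the doubling chain — CLOSED BY NAME** (rev 9: lift-p2 g18 `doublingChain`, p657997, constant `2^C + 3C + 3`, invariant `PosRootLawOn (min m s_j)` along `s_j = 2^j·2^C·K + 1`). -/
theorem stub_doublingChain : TowerB_of_sizeDoubling := by
  exact Summit.ValiantsHypothesis.ValiantsHypothesis.Theorems.KPlusLogSqLaw.TowerGraft.doublingChain

/-- **S5 (GL) the one-letter graft law — THE LINE'S CRUX** [research].  In the desk's graft calculus (STRUCTURE §4 C5/C28/C31/C55)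
this is the γ-BUDGET LAW on towers `Σ_{j<m} γ_j ≤ (2^C − 1)·ζ₊(m;d) + 2^{C·log₂²m}`; content begins where `ζ₊(m;d) > 2^{C·log₂²m}`. -/
theorem stub_oneLetterGraftLaw : TowerGraftLaw := by
  sorry

/-! ## Heads (no `sorry` below this line except through the stubs named) -/

/-- **HEAD (H1) — the declared restricted target:** (GL) ⇒ `TowerWeakLifting` (crux 19561 on tower supports, no tropical input). -/
theorem towerWeakLifting_of (hGL : TowerGraftLaw) : TowerWeakLifting :=
  towerWeakLifting_of_towerB (towerB_of_graftLaw hGL)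

/-- the line as registered: H1 through the stub S5. -/
theorem towerWeakLifting_skeleton : TowerWeakLifting := towerWeakLifting_of stub_oneLetterGraftLaw

/-- **JOINT (verdict #7 P1): the semidefinite rung is a literal special case of (GL)** — so S4 sits strictly below S5 in the
implication graph (`TowerGraftLaw → TowerGraftLawPSD`), and a proof of S4 is progress on a named sub-target of the line. -/
theorem towerGraftLawPSD_of_graftLaw (hGL : TowerGraftLaw) : TowerGraftLawPSD := by
  obtain ⟨C, hC⟩ := hGL
  refine ⟨C, fun m K B D d hd hD hB S P hS hP => ?_⟩
  have hPs : P.IsSymm := Matrix.isHermitian_iff_isSymm.mp hP.1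
  have hsymm : ∀ l, ((Fin.snoc S P : Fin (K + 1) → Matrix (Fin m) (Fin m) ℝ) l).IsSymm := by
    intro l
    refine Fin.lastCases ?_ (fun i => ?_) l
    · simpa using hPs
    · simpa using hS i
  have h := hC m K B D d hd hD hB (Fin.snoc S P) hsymm
  have hsum : (∑ l : Fin (K + 1), (X : ℝ[X]) ^ (Fin.snoc d D : Fin (K + 1) → ℕ) l •
      ((Fin.snoc S P : Fin (K + 1) → Matrix (Fin m) (Fin m) ℝ) l).map Polynomial.C) =
      (∑ l, ((X : ℝ[X]) ^ d l) • (S l).map Polynomial.C) + (X : ℝ[X]) ^ D • P.map Polynomial.C := by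
    rw [Fin.sum_univ_castSucc]
    simp
  rw [hsum] at h
  exact h

/-- **JOINT (rev 4): (GL-Id) is the special case `P = 1` of the semidefinite rung**, hence of (GL). -/
theorem towerGraftLawId_of_PSD (h : TowerGraftLawPSD) : TowerGraftLawId := by
  obtain ⟨C, hC⟩ := h
  refine ⟨C, fun m K B D d hd hD hB S hS => ?_⟩
  have h1 := hC m K B D d hd hD hB S (1 : Matrix (Fin m) (Fin m) ℝ) hS Matrix.PosSemidef.one
  simpa [Matrix.map_one Polynomial.C (map_zero Polynomial.C) (map_one Polynomial.C)] using h1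

theorem towerGraftLawId_of_graftLaw (hGL : TowerGraftLaw) : TowerGraftLawId :=
  towerGraftLawId_of_PSD (towerGraftLawPSD_of_graftLaw hGL)

/-- (GL-PD) from the two S4 stubs; and (GL-PD) ⇒ (GL-Id) back (`1` is positive definite), so the re-cut loses nothing. -/
theorem towerGraftLawPD_of : TowerGraftLawPD := stub_congruencePD stub_graftLawId

theorem towerGraftLawId_of_PD (h : TowerGraftLawPD) : TowerGraftLawId := by
  obtain ⟨C, hC⟩ := h
  refine ⟨C, fun m K B D d hd hD hB S hS => ?_⟩
  have h1 := hC m K B D d hd hD hB S (1 : Matrix (Fin m) (Fin m) ℝ) hS Matrix.PosDef.one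
  simpa [Matrix.map_one Polynomial.C (map_zero Polynomial.C) (map_one Polynomial.C)] using h1

/-- **JOINT (rev 5): the rank-one rung is the special case `P = v vᵀ ≽ 0` of the semidefinite rung**, hence of (GL). -/
theorem towerGraftLawRankOne_of_PSD (h : TowerGraftLawPSD) : TowerGraftLawRankOne := by
  obtain ⟨C, hC⟩ := h
  refine ⟨C, fun m K B D d hd hD hB S v hS => ?_⟩
  have hv : (Matrix.vecMulVec v v).PosSemidef := by
    simpa using Matrix.posSemidef_vecMulVec_self_star v
  exact hC m K B D d hd hD hB S (Matrix.vecMulVec v v) hS hv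

theorem towerGraftLawRankOne_of_graftLaw (hGL : TowerGraftLaw) : TowerGraftLawRankOne :=
  towerGraftLawRankOne_of_PSD (towerGraftLawPSD_of_graftLaw hGL)

/-- (GL-corner) is the special case `v = eᵢ` of (GL-rk1); with S4c the two are equivalent. -/
theorem towerGraftLawCorner_of_rankOne (h : TowerGraftLawRankOne) : TowerGraftLawCorner := by
  obtain ⟨C, hC⟩ := h
  exact ⟨C, fun m K B D d hd hD hB S i hS => hC m K B D d hd hD hB S (Pi.single i (1 : ℝ)) hS⟩

theorem towerGraftLawRankOne_of : TowerGraftLawRankOne := stub_cornerReduction stub_graftLawCorner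

/-- second typed attack on S4b inside the window: no graft at all (S4d) + the residual-determinant floor (S4e). -/
theorem towerGraftLawCornerW_of_sizeDoubling : TowerGraftLawCornerW := stub_cornerOfSizeDoubling stub_sizeDoubling

/-- (SD) ⇒ (SD-poly, fat form): the fat guard implies the window guard (`K ≤ 2^C·K`) and `2^C ≤ (m+2)^C`. -/
theorem towerSizeDoublingPoly_of_sizeDoubling (h : TowerSizeDoubling) : TowerSizeDoublingPoly := by
  obtain ⟨C, hC⟩ := h
  refine ⟨C, fun m K B d hK hd hB => posRootLawOn_mono ?_ (hC m K B d ?_ hd hB)⟩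
  · have h2 : 2 ^ C ≤ (m + 2) ^ C := Nat.pow_le_pow_left (by omega) C
    exact Nat.add_le_add_right (Nat.mul_le_mul_right B h2) _
  · exact le_trans (Nat.le_mul_of_pos_left K (Nat.two_pow_pos C)) hK

/-- **HEAD (H4) — the size-induction spine reaches the declared target through S4f + S4g + S4h alone (no graft law).** -/
theorem towerB_of_sizeDoublingPoly : TowerB := stub_doublingChain stub_sizeDoublingPoly stub_sizeMono

theorem towerWeakLifting_of_sizeDoubling : TowerWeakLifting := towerWeakLifting_of_towerB towerB_of_sizeDoublingPoly

/-- the window form is a literal restriction of (GL-corner). -/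
theorem towerGraftLawCornerW_of_corner (h : TowerGraftLawCorner) : TowerGraftLawCornerW := by
  obtain ⟨C, hC⟩ := h
  exact ⟨C, fun m K B D d _ hd hD hB S i hS => hC m K B D d hd hD hB S i hS⟩

/-- the empty format in the real currency. -/
theorem realRootLawAt_zero (m B : ℕ) : RealRootLawAt m 0 B := by
  intro d S hS
  have h0 : (∑ l : Fin 0, (Polynomial.X : Polynomial ℝ) ^ d l • (S l).map Polynomial.C) = 0 := by simp
  rw [h0]
  rcases Nat.eq_zero_or_pos m with hm | hm
  · subst hm
    simp [Matrix.det_isEmpty]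
  · haveI : Nonempty (Fin m) := ⟨⟨0, hm⟩⟩
    simp [Matrix.det_zero]

/-- **HEAD (H2) — B ⟺ DissociatedB** from S2 + S3: Conjecture B is a statement about dissociated chambers only. -/
theorem kPlusLogSqLaw_iff_dissociatedB_of
    (hBlow : ∀ (m K N : ℕ) (d e : Fin K → ℕ), IsDissociated m e → (∀ l, m * e l < N) →
      IsDissociated m (fun l => N * d l + e l))
    (hTie : ∀ (m K : ℕ), IsDissociated m (fun l : Fin K => (m + 1) ^ (l : ℕ)))
    (hR : DissociationReduction) : (KPlusLogSqLaw ↔ DissociatedB) := by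
  constructor
  · rintro ⟨C, hC⟩
    refine ⟨C, fun m K d _ S hS => ?_⟩
    exact (Finset.card_filter_le _ _).trans (hC m K d S hS)
  · rintro ⟨C, hC⟩
    refine ⟨C + 3, fun m K => ?_⟩
    rcases Nat.eq_zero_or_pos K with hK | hK
    · subst hK; exact realRootLawAt_zero m _
    set A := C * (K + Nat.log 2 m ^ 2) with hAdef
    -- every support `d` inherits the dissociated bound through the blow-up `N·d + e`, `e l = (m+1)^l`
    have hOn : ∀ d : Fin K → ℕ, PosRootLawOn m K (2 * 2 ^ A + 1) d := by
      intro d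
      refine hR m K (2 ^ A) d (fun l : Fin K => (m + 1) ^ (l : ℕ)) (hTie m K) ?_
      intro N hN
      exact hC m K _ (hBlow m K N d _ (hTie m K) hN)
    have hAt : Summit.ValiantsHypothesis.ValiantsHypothesis.Theorems.MatrixDescartes.Negative.PosRootLawAt m K
        (2 * 2 ^ A + 1) := fun d => hOn d
    have hReal := Summit.ValiantsHypothesis.ValiantsHypothesis.Theorems.LacunarySymmetroidMatrixDescartes.Census.realRootLawAt_of_posRootLawAt hAt
    refine Summit.ValiantsHypothesis.ValiantsHypothesis.Theorems.LacunarySymmetroidMatrixDescartes.Census.realRootLawAt_mono ?_ hReal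
    -- 2·(2·2^A + 1) + 1 ≤ 8·2^A ≤ 2^A · 2^{3(K+L²)} = 2^{(C+3)(K+L²)} with K ≥ 1
    have h5 : (C + 3) * (K + Nat.log 2 m ^ 2) = A + 3 * (K + Nat.log 2 m ^ 2) := by rw [hAdef]; ring
    have h6 : 3 ≤ 3 * (K + Nat.log 2 m ^ 2) := by omega
    have h7 : 2 ^ 3 ≤ 2 ^ (3 * (K + Nat.log 2 m ^ 2)) := Nat.pow_le_pow_right two_pos h6
    have h8 : 1 ≤ 2 ^ A := Nat.one_le_two_pow
    calc 2 * (2 * 2 ^ A + 1) + 1 ≤ 2 ^ A * 2 ^ 3 := by omega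
      _ ≤ 2 ^ A * 2 ^ (3 * (K + Nat.log 2 m ^ 2)) := Nat.mul_le_mul_left (2 ^ A) h7
      _ = 2 ^ ((C + 3) * (K + Nat.log 2 m ^ 2)) := by rw [h5, pow_add]

/-- **HEAD (H3) — the crux BY NAME from the B-equivalent hypothesis** `DissociatedB` (NOT a stub: it is B on all
dissociated chambers = TowerB (this line) ∪ the cluster-graft extension (future line)); via (H2) and p417903's
`weakLifting_of_kPlusLogSqLaw`.  Registered so the ledger sees where the line sits relative to `WeakLifting`. -/
theorem WeakLifting_of_dissociatedB
    (hBlow : ∀ (m K N : ℕ) (d e : Fin K → ℕ), IsDissociated m e → (∀ l, m * e l < N) →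
      IsDissociated m (fun l => N * d l + e l))
    (hTie : ∀ (m K : ℕ), IsDissociated m (fun l : Fin K => (m + 1) ^ (l : ℕ)))
    (hR : DissociationReduction) (hDB : DissociatedB) : WeakLifting := by
  have hB : KPlusLogSqLaw := (kPlusLogSqLaw_iff_dissociatedB_of hBlow hTie hR).mpr hDB
  obtain ⟨C, hC⟩ :=
    Summit.ValiantsHypothesis.ValiantsHypothesis.Theorems.LacunarySymmetroidMatrixDescartes.TropicalCensus.weakLifting_of_kPlusLogSqLaw hB
  exact ⟨C, fun m K n hT => hC m K n hT⟩

/-- **(H2) UNCONDITIONAL (rev 5)** — S2a/S2b/S3 are theorems of the tree (lift-p2 g17 p646383/p648275), and the iff itself landed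
as `Theorems/KPlusLogSqLawWeakLiftingTowerGraftDissociatedB.lean` (p650155): Conjecture B ⟺ B on `m`-dissociated supports. -/
theorem kPlusLogSqLaw_iff_dissociatedB : (KPlusLogSqLaw ↔ DissociatedB) :=
  Summit.ValiantsHypothesis.ValiantsHypothesis.Theorems.KPlusLogSqLaw.TowerGraft.kPlusLogSqLaw_iff_dissociatedB

/-- the same through the line's own joints (cross-check that the skeleton's H2 is the landed theorem's shape). -/
theorem kPlusLogSqLaw_iff_dissociatedB' : (KPlusLogSqLaw ↔ DissociatedB) :=
  kPlusLogSqLaw_iff_dissociatedB_of stub_blowupDissociated stub_towerTieBreaker stub_dissociationReduction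

/-- **(H3) UNCONDITIONAL IN THE STUBS (rev 5)**: the crux BY NAME from the single B-equivalent hypothesis `DissociatedB`. -/
theorem WeakLifting_of_dissociatedB' (hDB : DissociatedB) : WeakLifting :=
  WeakLifting_of_dissociatedB stub_blowupDissociated stub_towerTieBreaker stub_dissociationReduction hDB

/-! ## Rev 10 — the TOWER DOOR heads (δ-only: two compositions by name; no new stub, sorries unchanged = 5)

The door `Theorems/LacunarySymmetroidTowerDoor.lean :: TowerDoor.valiant_of_towerB_alone` (val-sym-eng-2 g7; content of
`Cruxes/MatrixDescartes/TowerDoorComplete.lean` @ca015990e815 landed def-free with every hypothesis inline) takes EXACTLY the text of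
`TowerB` (lex/tower supports carry the permanent witness: supports `(0,1,G,…,G^{n-1})`, `G = 2^n > m`, are `m`-towers).  Hence the
line's two proved spines reach the SUMMIT by name: (GL) = S5 ⇒ `TowerB` (`towerB_of_graftLaw`) ⇒ `ValiantsHypothesis`, and
(SD-poly) = S4f (+ S4g, S4h closed by name) ⇒ `TowerB` ⇒ `ValiantsHypothesis`.  Route-level re-gluing is the director's / the
human's call (b141); this block only records the compositions inside the registered skeleton. -/

/-- door identity check inside the skeleton: the door's hypothesis text IS `TowerB` (definitionally). -/
theorem towerB_door_iff :
    (∃ C : ℕ, ∀ (m K : ℕ) (d : Fin K → ℕ), (∀ l l' : Fin K, l < l' → m * d l < d l') →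
      PosRootLawOn m K (2 ^ (C * (K + Nat.log 2 m ^ 2))) d) ↔ TowerB := Iff.rfl

/-- **HEAD (H5, rev 10) — S5 ALONE IS SUMMIT-DECIDING BY NAME:** (GL) ⇒ `TowerB` ⇒ `ValiantsHypothesis` through the tower door.
Sorry-free in this file; (GL) is the OPEN stub S5 — VP ≠ VNP is NOT proved. -/
theorem valiant_of_graftLaw (hGL : TowerGraftLaw) : _root_.ValiantsHypothesis :=
  Summit.ValiantsHypothesis.ValiantsHypothesis.Theorems.LacunarySymmetroid.TowerDoor.valiant_of_towerB_alone
    (towerB_of_graftLaw hGL)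

/-- **HEAD (H6, rev 10) — S4f ALONE IS SUMMIT-DECIDING BY NAME:** (SD-poly) + S4g + S4h (both CLOSED by name, p658112 / p657997)
⇒ `TowerB` ⇒ `ValiantsHypothesis`.  Sorry-free in this file; (SD-poly) is the OPEN stub S4f — VP ≠ VNP is NOT proved. -/
theorem valiant_of_sizeDoublingPoly (hSD : TowerSizeDoublingPoly) : _root_.ValiantsHypothesis :=
  Summit.ValiantsHypothesis.ValiantsHypothesis.Theorems.LacunarySymmetroid.TowerDoor.valiant_of_towerB_alone
    (stub_doublingChain hSD stub_sizeMono)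

/-- the line as registered, at the summit, through S5 (uses the `sorry` of `stub_oneLetterGraftLaw` only). -/
theorem valiant_skeleton_of_S5 : _root_.ValiantsHypothesis := valiant_of_graftLaw stub_oneLetterGraftLaw

/-- the line as registered, at the summit, through S4f (uses the `sorry` of `stub_sizeDoublingPoly` only). -/
theorem valiant_skeleton_of_S4f : _root_.ValiantsHypothesis := valiant_of_sizeDoublingPoly stub_sizeDoublingPoly

/-! ## Rev 11 — the POLYLOG GRAFT LAW (GLᴸ): a WEAKER load-bearing statement that still decides the summit

The door `TowerDoor.closes_tower` does not consume B-strength: its root-counting hypothesis is the TOWER-MDR window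
`card^q ≤ 2^{K·log₂K}` for `m ≤ 2^{(log₂K + c)^c}` (every `c, q`, all large `K`).  In that window a per-graft FACTOR
POLYLOGARITHMIC in `m` and an additive quasi-polynomial term of ANY fixed order are affordable:
`((log₂m + 2)^E)^K = 2^{O(E·K·log log K)} = 2^{o(K log K)}` and `2^{(log₂m+2)^A} = 2^{polylog K}`.  Hence

  (GLᴸ) `ζ₊(m; d ⊔ D) ≤ (log₂m + 2)^E · ζ₊(m; d) + 2^{(log₂m + 2)^A}`   on towers (`D > m·max d`)

is door-deciding (`valiant_of_graftLawPolylog`, sorry-free below modulo the ONE research stub `stub_graftLawPolylog`), and it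
is implied by S5 (`graftLawPolylog_of_graftLaw`, `E = C`, `A = C + 2`) — the line's summit spine can be cut from «constant
factor per graft» (B-currency, needed for `TowerB` / the crux-restricted `TowerWeakLifting`) to «polylog factor per graft»
(door currency).  `TowerB ⇒ TowerPolylogLaw` too, so the S4f spine feeds the same head.  Nothing here is unconditional:
GLᴸ is OPEN; VP ≠ VNP is NOT proved. -/

/-- **(GLᴸ) — THE POLYLOG GRAFT LAW** (door currency; weaker than (GL) = S5): on a tower, grafting ONE far letter costs at
most a factor `(log₂ m + 2)^E` plus an additive `2^{(log₂ m + 2)^A}`. -/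
def TowerGraftLawPolylog : Prop :=
  ∃ E A : ℕ, ∀ (m K B D : ℕ) (d : Fin K → ℕ), IsTower m d → (∀ l, m * d l < D) →
    PosRootLawOn m K B d →
    PosRootLawOn m (K + 1) ((Nat.log 2 m + 2) ^ E * B + 2 ^ ((Nat.log 2 m + 2) ^ A)) (Fin.snoc d D)

/-- **TOWER POLYLOG LAW** — (GLᴸ) iterated: `ζ₊ ≤ (2(log₂m+2)^E)^K · 2^{(log₂m+2)^A}` on every `m`-tower.
NOT census-answered, not tower-data-refuted (check for the FIXED constants `(E, A) = (1, 2)`): whenever `K ≤ log₂m + 2` the additive term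
alone dominates Descartes (`ζ₊ ≤ m^K ≤ 2^{K(L+1)} ≤ 2^{(L+2)²}`, `L = ⌊log₂m⌋`) — this covers the K = 3 tower column
`ζ_sym(m,3) = C(m+2,2) − 1 = (m²+3m)/2` on `(0,1,D)` (`LagrangeTower.not_posRootLawAt_three`), the K = 4 Lagrange-tower rows `≥ (m+1)² − 1`
(`not_posRootLawAt_four`, (6,4)…(10,4), (16,4)) and the record staircase (a tower family peaking at `K ≈ ¼·log₂m`, `log ζ ≈ (K/6)·log m`);
for `m ≤ 2^{10}` and every `K` one checks `C(m+K−1, m) ≤ (2(L+2))^K · 2^{(L+2)²}` directly (exact integer check, this seat).  With `(1,2)` the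
law stops being a consequence of Descartes only from `m ≈ 2^{12}` on (there for `110 ≤ K ≤ 199`; at `m = 2^{16}` from `K = 52`) — beyond every
census; its content, like `TowerB`'s, lives at `K ≳ log₂ m` letters of size `m` in the thousands. -/
def TowerPolylogLaw : Prop :=
  ∃ E A : ℕ, ∀ (m K : ℕ) (d : Fin K → ℕ), IsTower m d →
    PosRootLawOn m K ((2 * (Nat.log 2 m + 2) ^ E) ^ K * 2 ^ ((Nat.log 2 m + 2) ^ A)) d

/-- **TOWER-MDR** — the door's root-counting hypothesis verbatim (`TowerDoor.closes_tower`, first binder): the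
tower-restricted `MatrixDescartes` window. -/
def TowerMDR : Prop :=
  ∀ c q : ℕ, 0 < q → ∃ K₀ : ℕ, ∀ K m : ℕ, K₀ ≤ K → m ≤ 2 ^ ((Nat.log 2 K + c) ^ c) →
    ∀ (d : Fin K → ℕ) (S : Fin K → Matrix (Fin m) (Fin m) ℝ), (∀ l l' : Fin K, l < l' → m * d l < d l') →
      (∀ l, (S l).IsSymm) →
        (Matrix.det (∑ l, ((Polynomial.X : Polynomial ℝ) ^ d l) • (S l).map Polynomial.C)).roots.toFinset.card ^ q
          ≤ 2 ^ (K * Nat.log 2 K)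

/-- S5 ⇒ GLᴸ: `2^C ≤ (L+2)^C` and `C·L² ≤ (L+2)^{C+2}` (`L = log₂ m`). -/
theorem graftLawPolylog_of_graftLaw (h : TowerGraftLaw) : TowerGraftLawPolylog := by
  obtain ⟨C, hC⟩ := h
  refine ⟨C, C + 2, fun m K B D d hd hD hB => ?_⟩
  refine posRootLawOn_mono ?_ (hC m K B D d hd hD hB)
  set L := Nat.log 2 m with hL
  have h1 : 2 ^ C ≤ (L + 2) ^ C := Nat.pow_le_pow_left (by omega) C
  have h2 : C ≤ 2 ^ C := Nat.lt_two_pow_self.le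
  have h3 : C * L ^ 2 ≤ (L + 2) ^ (C + 2) := by
    have h4 : L ^ 2 ≤ (L + 2) ^ 2 := Nat.pow_le_pow_left (by omega) 2
    calc C * L ^ 2 ≤ 2 ^ C * (L + 2) ^ 2 := Nat.mul_le_mul h2 h4
      _ ≤ (L + 2) ^ C * (L + 2) ^ 2 := Nat.mul_le_mul_right _ h1
      _ = (L + 2) ^ (C + 2) := by rw [← pow_add]
  have h5 : 2 ^ (C * L ^ 2) ≤ 2 ^ ((L + 2) ^ (C + 2)) := Nat.pow_le_pow_right two_pos h3
  exact Nat.add_le_add (Nat.mul_le_mul_right _ h1) h5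

/-- the iteration arithmetic: `P·((2P)^K·R) + R ≤ (2P)^{K+1}·R` for `P ≥ 1`. -/
theorem polylog_step_arith (P K R : ℕ) (hP : 1 ≤ P) :
    P * ((2 * P) ^ K * R) + R ≤ (2 * P) ^ (K + 1) * R := by
  have h1 : R ≤ P * ((2 * P) ^ K * R) := by
    have h2 : 1 ≤ P * (2 * P) ^ K := Nat.one_le_iff_ne_zero.mpr (by positivity)
    calc R = 1 * R := (one_mul R).symm
      _ ≤ (P * (2 * P) ^ K) * R := Nat.mul_le_mul_right R h2
      _ = P * ((2 * P) ^ K * R) := by ring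
  have h3 : (2 * P) ^ (K + 1) * R = P * ((2 * P) ^ K * R) + P * ((2 * P) ^ K * R) := by ring
  rw [h3]
  exact Nat.add_le_add_left h1 _

/-- **(GLᴸ) iterated = the tower polylog law** (induction on `K` along `Fin.init`, as `towerB_of_graftLaw`). -/
theorem towerPolylogLaw_of_graftLawPolylog (h : TowerGraftLawPolylog) : TowerPolylogLaw := by
  obtain ⟨E, A, hC⟩ := h
  refine ⟨E, A, ?_⟩
  intro m K
  induction K with
  | zero => intro d _; exact posRootLawOn_zero m _ d
  | succ K ih =>
    intro d hd
    have h₁ := ih (Fin.init d) (isTower_init hd)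
    have h₂ := hC m K _ (d (Fin.last K)) (Fin.init d) (isTower_init hd) (tower_init_lt_last hd) h₁
    rw [Fin.snoc_init_self] at h₂
    refine posRootLawOn_mono ?_ h₂
    exact polylog_step_arith _ K _ (Nat.one_le_iff_ne_zero.mpr (by positivity))

/-- `TowerB ⇒ TowerPolylogLaw` (`E = C`, `A = C + 2`): the S4f spine feeds the polylog head as well. -/
theorem towerPolylogLaw_of_towerB (h : TowerB) : TowerPolylogLaw := by
  obtain ⟨C, hC⟩ := h
  refine ⟨C, C + 2, fun m K d hd => posRootLawOn_mono ?_ (hC m K d hd)⟩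
  set L := Nat.log 2 m with hL
  have h1 : 2 ^ C ≤ 2 * (L + 2) ^ C :=
    calc 2 ^ C ≤ (L + 2) ^ C := Nat.pow_le_pow_left (by omega) C
      _ ≤ 2 * (L + 2) ^ C := Nat.le_mul_of_pos_left _ two_pos
  have h2 : C ≤ 2 ^ C := Nat.lt_two_pow_self.le
  have h3 : C * L ^ 2 ≤ (L + 2) ^ (C + 2) := by
    have h4 : L ^ 2 ≤ (L + 2) ^ 2 := Nat.pow_le_pow_left (by omega) 2
    have h6 : 2 ^ C ≤ (L + 2) ^ C := Nat.pow_le_pow_left (by omega) C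
    calc C * L ^ 2 ≤ 2 ^ C * (L + 2) ^ 2 := Nat.mul_le_mul h2 h4
      _ ≤ (L + 2) ^ C * (L + 2) ^ 2 := Nat.mul_le_mul_right _ h6
      _ = (L + 2) ^ (C + 2) := by rw [← pow_add]
  calc 2 ^ (C * (K + L ^ 2)) = (2 ^ C) ^ K * 2 ^ (C * L ^ 2) := by
        rw [mul_add, pow_add, pow_mul]
    _ ≤ (2 * (L + 2) ^ C) ^ K * 2 ^ ((L + 2) ^ (C + 2)) :=
        Nat.mul_le_mul (Nat.pow_le_pow_left h1 K) (Nat.pow_le_pow_right two_pos h3)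

/-- nested-log budget, multiplicative part: `2q·(E·c₁·(log₂(log₂K + c₂) + 1) + E + 1) ≤ log₂ K` for all large `K`. -/
theorem loglog_budget (a b : ℕ) : ∃ X₀ : ℕ, ∀ x : ℕ, X₀ ≤ x → a * (Nat.log 2 (x + b) + 1) ≤ x := by
  obtain ⟨L₁, hL₁⟩ :=
    Summit.ValiantsHypothesis.ValiantsHypothesis.Theorems.LacunarySymmetroidMatrixDescartes.StubArith4.poly_le_two_pow 1 (a + b)
  refine ⟨2 ^ L₁, fun x hx => ?_⟩
  set μ := Nat.log 2 (x + b) with hμ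
  have hxb0 : x + b ≠ 0 := by have := Nat.one_le_two_pow (n := L₁); omega
  have hμL : L₁ ≤ μ := Nat.le_log_of_pow_le one_lt_two (by omega)
  have h1 : (a + b) * (μ + 1) ^ 1 ≤ 2 ^ μ := hL₁ μ hμL
  have h2 : 2 ^ μ ≤ x + b := Nat.pow_log_le_self 2 hxb0
  have h3 : (a + b) * (μ + 1) ^ 1 = a * (μ + 1) + b * (μ + 1) := by ring
  have h4 : b ≤ b * (μ + 1) := Nat.le_mul_of_pos_right _ (by omega)
  omega

/-- `log₂ m ≤ (log₂K + c)^c` puts `log₂ m + 2 ≤ (log₂ K + c + 3)^{c+1}`. -/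
theorem logm_window {L x c : ℕ} (h : L ≤ (x + c) ^ c) : L + 2 ≤ (x + c + 3) ^ (c + 1) := by
  have h1 : (x + c) ^ c ≤ (x + c + 1) ^ c := Nat.pow_le_pow_left (by omega) c
  have h2 : (x + c + 1) ^ c ≤ (x + c + 1) ^ (c + 1) := Nat.pow_le_pow_right (by omega) (by omega)
  have h3 : (x + c + 1) ^ (c + 1) + 2 ^ (c + 1) ≤ (x + c + 1 + 2) ^ (c + 1) :=
    pow_add_pow_le (by omega) (by omega) (by omega)
  have h4 : 2 ≤ 2 ^ (c + 1) := by
    calc 2 = 2 ^ 1 := (pow_one 2).symm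
      _ ≤ 2 ^ (c + 1) := Nat.pow_le_pow_right two_pos (by omega)
  have h5 : x + c + 1 + 2 = x + c + 3 := by ring
  rw [h5] at h3
  omega

/-- `log₂ (y^n) ≤ n·(log₂ y + 1)`. -/
theorem log_pow_le (y n : ℕ) : Nat.log 2 (y ^ n) ≤ n * (Nat.log 2 y + 1) := by
  rcases Nat.eq_zero_or_pos y with hy | hy
  · subst hy
    rcases Nat.eq_zero_or_pos n with hn | hn
    · subst hn; simp
    · rw [zero_pow (by omega)]; simp
  · rcases Nat.eq_zero_or_pos n with hn | hn
    · subst hn; simp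
    · have h1 : y < 2 ^ (Nat.log 2 y + 1) := Nat.lt_pow_succ_log_self one_lt_two y
      have h2 : y ^ n < (2 ^ (Nat.log 2 y + 1)) ^ n := Nat.pow_lt_pow_left h1 (by omega)
      rw [← pow_mul] at h2
      have h3 : Nat.log 2 (y ^ n) < (Nat.log 2 y + 1) * n := Nat.log_lt_of_lt_pow (by positivity) h2
      rw [mul_comm] at h3
      omega

/-- **THE DOOR JOINT (door currency)**: `TowerPolylogLaw → TowerMDR` — reflection `X ↦ −X` (`stub_negRoots`:
`card ≤ ζ₊(S) + ζ₊(S⁻) + 1 ≤ 4·bound`) and the nested-log arithmetic above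
(`q·(2 + K·(E(λ+1)+1) + (L+2)^A) ≤ K·log₂K` with `λ = log₂(L+2)`, `L = log₂ m ≤ (log₂K + c)^c`). -/
theorem towerMDR_of_towerPolylogLaw (h : TowerPolylogLaw) : TowerMDR := by
  obtain ⟨E, A, hC⟩ := h
  intro c q hq
  -- constants
  set c₁ := c + 1 with hc₁
  set c₃ := c + 3 with hc₃
  -- (a) multiplicative budget: 2q(E c₁ (log₂(x + c₃) + 1) + E + 1) ≤ x for x ≥ X₀
  obtain ⟨X₀, hX₀⟩ := loglog_budget (2 * q * (E * c₁ + E + 1)) c₃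
  -- (b) additive budget: 6q (x + c₄)^{c₄} ≤ K x for K ≥ K₁, with c₄ = c₃ + c₁ * A
  set c₄ := c₃ + c₁ * A with hc₄
  obtain ⟨K₁, hK₁⟩ :=
    Summit.ValiantsHypothesis.ValiantsHypothesis.Theorems.LacunarySymmetroidMatrixDescartes.StubArith4.exp_le c₄ (6 * q)
  refine ⟨max K₁ (2 ^ X₀), fun K m hK hm d S hd hS => ?_⟩
  have hKK₁ : K₁ ≤ K := le_of_max_le_left hK
  have hK2 : 2 ^ X₀ ≤ K := le_of_max_le_right hK
  set x := Nat.log 2 K with hx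
  have hxX : X₀ ≤ x := Nat.le_log_of_pow_le one_lt_two hK2
  set L := Nat.log 2 m with hLdef
  have hLwin : L ≤ (x + c) ^ c :=
    calc L ≤ Nat.log 2 (2 ^ ((x + c) ^ c)) := Nat.log_mono_right hm
      _ = (x + c) ^ c := Nat.log_pow one_lt_two _
  have hL2 : L + 2 ≤ (x + c₃) ^ c₁ := by
    rw [hc₃, hc₁, ← add_assoc]
    exact logm_window hLwin
  -- the law and its reflection
  have h1 := hC m K d hd S hS
  have h2 := hC m K d hd (fun l => ((-1 : ℝ) ^ d l) • S l) (fun l => (hS l).smul _)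
  have h3 := Summit.ValiantsHypothesis.ValiantsHypothesis.Theorems.LacunarySymmetroidMatrixDescartes.stub_negRoots K m d S
  set Bd := (2 * (L + 2) ^ E) ^ K * 2 ^ ((L + 2) ^ A) with hBd
  have hBd1 : 1 ≤ Bd := Nat.one_le_iff_ne_zero.mpr (by positivity)
  have hcard : (Matrix.det (∑ l, ((Polynomial.X : Polynomial ℝ) ^ d l) • (S l).map Polynomial.C)).roots.toFinset.card
      ≤ 4 * Bd := by
    have := h3.trans (Nat.add_le_add (Nat.add_le_add h1 h2) le_rfl)
    omega
  -- Bd ≤ 2^{K (E(λ+1)+1) + (L+2)^A}, λ = log₂(L+2)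
  set lam := Nat.log 2 (L + 2) with hlam
  have hL2pow : L + 2 ≤ 2 ^ (lam + 1) := (Nat.lt_pow_succ_log_self one_lt_two (L + 2)).le
  have hfac : 2 * (L + 2) ^ E ≤ 2 ^ (E * (lam + 1) + 1) := by
    calc 2 * (L + 2) ^ E ≤ 2 * (2 ^ (lam + 1)) ^ E := Nat.mul_le_mul_left 2 (Nat.pow_le_pow_left hL2pow E)
      _ = 2 ^ (E * (lam + 1) + 1) := by rw [← pow_mul, pow_succ', mul_comm (lam + 1) E]
  have hBdpow : 4 * Bd ≤ 2 ^ (2 + K * (E * (lam + 1) + 1) + (L + 2) ^ A) := by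
    calc 4 * Bd = 2 ^ 2 * ((2 * (L + 2) ^ E) ^ K * 2 ^ ((L + 2) ^ A)) := by rw [hBd]; norm_num
      _ ≤ 2 ^ 2 * ((2 ^ (E * (lam + 1) + 1)) ^ K * 2 ^ ((L + 2) ^ A)) :=
          Nat.mul_le_mul_left _ (Nat.mul_le_mul_right _ (Nat.pow_le_pow_left hfac K))
      _ = 2 ^ (2 + K * (E * (lam + 1) + 1) + (L + 2) ^ A) := by
          rw [← pow_mul, ← pow_add, ← pow_add]; congr 1; ring
  -- (a): lam + 1 ≤ c₁ (log₂(x+c₃) + 1), then the loglog budget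
  have hlam_le : lam + 1 ≤ c₁ * (Nat.log 2 (x + c₃) + 1) := by
    have e1 : lam ≤ Nat.log 2 ((x + c₃) ^ c₁) := Nat.log_mono_right hL2
    have e2 := log_pow_le (x + c₃) c₁
    have e3 : 1 ≤ c₁ := by omega
    have e4 : c₁ * (Nat.log 2 (x + c₃) + 1) ≥ c₁ := Nat.le_mul_of_pos_right _ (by omega)
    -- lam ≤ c₁ (log+1) and we need lam + 1 ≤ c₁ (log + 1): use lam < ... via strict version
    have h1' : L + 2 < 2 ^ (lam + 1) := Nat.lt_pow_succ_log_self one_lt_two (L + 2)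
    -- strict: (x+c₃)^c₁ < 2^{c₁ (log₂(x+c₃)+1)} hence lam < c₁ (log+1)
    have f1 : x + c₃ < 2 ^ (Nat.log 2 (x + c₃) + 1) := Nat.lt_pow_succ_log_self one_lt_two _
    have f2 : (x + c₃) ^ c₁ < (2 ^ (Nat.log 2 (x + c₃) + 1)) ^ c₁ := Nat.pow_lt_pow_left f1 (by omega)
    rw [← pow_mul] at f2
    have f3 : L + 2 < 2 ^ ((Nat.log 2 (x + c₃) + 1) * c₁) := lt_of_le_of_lt hL2 f2
    have f4 : lam < (Nat.log 2 (x + c₃) + 1) * c₁ := Nat.log_lt_of_lt_pow (by omega) f3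
    rw [mul_comm] at f4
    omega
  have ha : 2 * q * (K * (E * (lam + 1) + 1)) ≤ K * x := by
    have g1 : E * (lam + 1) + 1 ≤ E * c₁ * (Nat.log 2 (x + c₃) + 1) + E + 1 := by
      have := Nat.mul_le_mul_left E hlam_le
      have g2 : E * (c₁ * (Nat.log 2 (x + c₃) + 1)) = E * c₁ * (Nat.log 2 (x + c₃) + 1) := by ring
      omega
    have g3 : E * c₁ * (Nat.log 2 (x + c₃) + 1) + E + 1 ≤ (E * c₁ + E + 1) * (Nat.log 2 (x + c₃) + 1) := by
      have g4 : E + 1 ≤ (E + 1) * (Nat.log 2 (x + c₃) + 1) := Nat.le_mul_of_pos_right _ (by omega)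
      have g5 : (E * c₁ + E + 1) * (Nat.log 2 (x + c₃) + 1) =
          E * c₁ * (Nat.log 2 (x + c₃) + 1) + (E + 1) * (Nat.log 2 (x + c₃) + 1) := by ring
      omega
    have g6 : 2 * q * (E * c₁ + E + 1) * (Nat.log 2 (x + c₃) + 1) ≤ x := by
      have := hX₀ x hxX
      simpa [mul_assoc] using this
    calc 2 * q * (K * (E * (lam + 1) + 1)) = K * (2 * q * (E * (lam + 1) + 1)) := by ring
      _ ≤ K * (2 * q * ((E * c₁ + E + 1) * (Nat.log 2 (x + c₃) + 1))) :=
          Nat.mul_le_mul_left K (Nat.mul_le_mul_left _ (g1.trans g3))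
      _ = K * (2 * q * (E * c₁ + E + 1) * (Nat.log 2 (x + c₃) + 1)) := by ring
      _ ≤ K * x := Nat.mul_le_mul_left K g6
  -- (b): 2q(2 + (L+2)^A) ≤ 6q (x + c₄)^{c₄} ≤ K x
  have hb : 2 * q * (2 + (L + 2) ^ A) ≤ K * x := by
    have g1 : (L + 2) ^ A ≤ (x + c₄) ^ c₄ := by
      calc (L + 2) ^ A ≤ ((x + c₃) ^ c₁) ^ A := Nat.pow_le_pow_left hL2 A
        _ = (x + c₃) ^ (c₁ * A) := by rw [← pow_mul]
        _ ≤ (x + c₄) ^ (c₁ * A) := Nat.pow_le_pow_left (by omega) _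
        _ ≤ (x + c₄) ^ c₄ := Nat.pow_le_pow_right (by omega) (by omega)
    have g2 : 1 ≤ (x + c₄) ^ c₄ := Nat.one_le_iff_ne_zero.mpr (by positivity)
    have g3 : 6 * q * (x + c₄) ^ c₄ ≤ K * x := hK₁ K hKK₁
    have g4 : 2 * q * (2 + (L + 2) ^ A) ≤ 6 * q * (x + c₄) ^ c₄ := by
      have g5 : 2 + (L + 2) ^ A ≤ 3 * (x + c₄) ^ c₄ := by omega
      calc 2 * q * (2 + (L + 2) ^ A) ≤ 2 * q * (3 * (x + c₄) ^ c₄) := Nat.mul_le_mul_left _ g5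
        _ = 6 * q * (x + c₄) ^ c₄ := by ring
    exact g4.trans g3
  -- assemble the exponent comparison
  have hexp : q * (2 + K * (E * (lam + 1) + 1) + (L + 2) ^ A) ≤ K * x := by
    have e1 : 2 * (q * (2 + K * (E * (lam + 1) + 1) + (L + 2) ^ A)) =
        2 * q * (K * (E * (lam + 1) + 1)) + 2 * q * (2 + (L + 2) ^ A) := by ring
    have e2 : 2 * (q * (2 + K * (E * (lam + 1) + 1) + (L + 2) ^ A)) ≤ 2 * (K * x) := by
      rw [e1]; omega
    exact Nat.le_of_mul_le_mul_left e2 two_pos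
  calc (Matrix.det (∑ l, ((Polynomial.X : Polynomial ℝ) ^ d l) • (S l).map Polynomial.C)).roots.toFinset.card ^ q
      ≤ (4 * Bd) ^ q := Nat.pow_le_pow_left hcard q
    _ ≤ (2 ^ (2 + K * (E * (lam + 1) + 1) + (L + 2) ^ A)) ^ q := Nat.pow_le_pow_left hBdpow q
    _ = 2 ^ (q * (2 + K * (E * (lam + 1) + 1) + (L + 2) ^ A)) := by rw [← pow_mul, mul_comm]
    _ ≤ 2 ^ (K * x) := Nat.pow_le_pow_right two_pos hexp

/-- **STUB S5ᴸ (`stub_graftLawPolylog`) — RESEARCH, door currency, WEAKER THAN S5** (`graftLawPolylog_of_graftLaw`).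
Why it might fail: the same mechanism as S5 — an INDEFINITE far letter births branch arcs of `det(G(t)+T·S) = 0`; if the
per-graft factor grows polynomially in `m` deep in the tower (as it does at the first graft, `ζ(m;3)/ζ(m;2) = (m+3)/2`,
there absorbed by the additive term) once `K ≳ (log₂ m)^{A-1}`, no polylog factor holds.  No census reaches that regime.
What it buys the research (memo `tower_graft-S5.md` §3 T1/T2/T3, §9.1): the ADDITIVE budgets of T2/T3 (near-event / thin-sector / fold counts)
may now be quasi-polynomial of ANY fixed order — dischargeable by generic real-root bounds (Descartes / Khovanskii type) on sub-strings of
`(log₂ m)^{A−1}` digits or letters, where S5 affords only `O(log₂ m)`; and a MULTIPLICATIVE loss `(log₂ m)^{O(1)}` per graft is admissible —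
any far-field instrument that pays the budget `B` once per level of a ladder with polylog(m) levels (a dyadic log-slope band decomposition of
the far field; the probe-level ladder of `…TowerGraftProbeDictionary`, `probe_level_unique`) qualifies, where S5 demanded `O(1)` levels.  The
constant-factor instruments of record (T1 root-sum discs `…TowerGraftClusterDiscs` / `…RootSumDiscs`, causal Descartes `≤ 2·#touching`) are
unchanged by it.  Sources: memo §3–§9; door `Theorems/LacunarySymmetroidTowerDoor.lean` (p672005); `StubArith4` (the MDR arithmetic). -/
theorem stub_graftLawPolylog : TowerGraftLawPolylog := by
  sorry

/-- **HEAD (H7, rev 11) — GLᴸ ALONE IS SUMMIT-DECIDING BY NAME** (door currency):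
GLᴸ ⇒ `TowerPolylogLaw` ⇒ `TowerMDR` ⇒ `ValiantsHypothesis` (`TowerDoor.closes_tower` with the tree's `pencilTransfer_proof`
and `towerThetaWitness_holds`).  Sorry-free in this file; GLᴸ is the OPEN stub S5ᴸ — VP ≠ VNP is NOT proved. -/
theorem valiant_of_graftLawPolylog (h : TowerGraftLawPolylog) : _root_.ValiantsHypothesis :=
  Summit.ValiantsHypothesis.ValiantsHypothesis.Theorems.LacunarySymmetroid.TowerDoor.closes_tower
    (towerMDR_of_towerPolylogLaw (towerPolylogLaw_of_graftLawPolylog h))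
    Summit.ValiantsHypothesis.ValiantsHypothesis.Theorems.LacunarySymmetroid.pencilTransfer_proof
    Summit.ValiantsHypothesis.ValiantsHypothesis.Theorems.LacunarySymmetroid.TowerDoor.towerThetaWitness_holds

/-- the polylog head from the tower polylog law itself (both spines feed it: `towerPolylogLaw_of_towerB`). -/
theorem valiant_of_towerPolylogLaw (h : TowerPolylogLaw) : _root_.ValiantsHypothesis :=
  Summit.ValiantsHypothesis.ValiantsHypothesis.Theorems.LacunarySymmetroid.TowerDoor.closes_tower
    (towerMDR_of_towerPolylogLaw h)
    Summit.ValiantsHypothesis.ValiantsHypothesis.Theorems.LacunarySymmetroid.pencilTransfer_proof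
    Summit.ValiantsHypothesis.ValiantsHypothesis.Theorems.LacunarySymmetroid.TowerDoor.towerThetaWitness_holds

/-- consistency: the S5 head factors through the polylog head (S5 ⇒ S5ᴸ). -/
theorem valiant_of_graftLaw' (hGL : TowerGraftLaw) : _root_.ValiantsHypothesis :=
  valiant_of_graftLawPolylog (graftLawPolylog_of_graftLaw hGL)

/-- the line as registered, at the summit, through S5ᴸ (uses the `sorry` of `stub_graftLawPolylog` only). -/
theorem valiant_skeleton_of_S5L : _root_.ValiantsHypothesis := valiant_of_graftLawPolylog stub_graftLawPolylog


/-! ### Rev 12 (δ-only): S5 is NAMED in Theorems (`Theorems/TowerDoorS5Conjecture.lean`, val-sym-eng-2 g7 p677624;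
director-valiant R313/R317, 21-frontier b141 «keep ONE: TowerDoorS5»).  The door route's crux decl
`Theorems.TowerDoorS5.TowerGraftLaw` is by DEFINITION this line's S5; the two pins below make that identity and the
door head hold BY NAME inside the line file (drift-proof in both directions, as `towerB_door_iff` does for TowerB):
a kernel proof of `stub_oneLetterGraftLaw` closes the door decl by `Iff.rfl`/`id`.  Nothing new is claimed. -/

/-- δ-pin (rev 12): the door route's named conjecture IS this line's S5, definitionally. -/
theorem towerGraftLaw_doorS5_iff :
    TowerGraftLaw ↔ Summit.ValiantsHypothesis.ValiantsHypothesis.Theorems.TowerDoorS5.TowerGraftLaw := Iff.rfl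

/-- δ-pin (rev 12): the summit from S5 through the NAMED door head `TowerDoorS5.valiant_of_towerGraftLaw`
(= `valiant_of_towerB_alone ∘ towerB_of_towerGraftLaw`, p677624); agrees with `valiant_of_graftLaw` (rev 10). -/
theorem valiant_of_graftLaw_byDoorS5 (hGL : TowerGraftLaw) : _root_.ValiantsHypothesis :=
  Summit.ValiantsHypothesis.ValiantsHypothesis.Theorems.TowerDoorS5.valiant_of_towerGraftLaw
    (towerGraftLaw_doorS5_iff.mp hGL)

end Summit.ValiantsHypothesis.ValiantsHypothesis.Cruxes.WeakLifting.TowerGraftLine
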